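import Mathlib.GroupTheory.GroupAction.Quotient
import Mathlib.Data.Set.Card
import Mathlib.Algebra.BigOperators.Finprod
import Mathlib.Tactic.Group
import HarnessLib

/-!
# Transport of fixed points and fixed-point sums on coset spaces along a group isomorphism

Topic `GroupTheory`; namespace `Literature.GroupTheory`.  THEOREMS ONLY (no definition, no instance, no notation, no named fact, no `sorry`); Mathlib-only.  Generic
lemma of the road «R1LL-tree» (cell `pub/hodgecm-mathlib`, crux H413 = `stmt-HodgeConjecture-24833`; architect A-p16 (g27), RULING A-13, brick I-7 «`H_v` transport»):
along the one-place model `e : U(Φ₂)(L⁺_v) ≃* U(σ_w, (Φ₂)_w)(L_w)` with `e(K) = K′`, the finite-group unfoldings of orbital integrals (fixed-point sums `Σ_{q ∈ Fix_γ(G⧸K)} f(q.out⁻¹ γ q.out)`)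
agree.

* `exists_equiv_quotient_congr` — `Ψ : G ⧸ K ≃ G′ ⧸ K′` with `Ψ (mk g) = mk (e g)` and `Ψ (γ • q) = e γ • Ψ q`, for `e : G ≃* G′`, `g ∈ K ↔ e g ∈ K′`.
* `image_fixedBy_quotient_congr_eq`, `ncard_sep_fixedBy_quotient_congr_eq` — fixed points (and their strata by any predicate) correspond.
* `apply_out_conj_congr_eq_of_conj_invariant`, `finsum_mem_fixedBy_quotient_congr_eq` — for `f′ : G′ → E` invariant under `K′`-conjugation:
  `Σᶠ_{q ∈ Fix_γ(G⧸K)} f′ (e (q.out⁻¹ γ q.out)) = Σᶠ_{p ∈ Fix_{eγ}(G′⧸K′)} f′ (p.out⁻¹ (e γ) p.out)`.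
[BourbakiAlgebraI1989 Ch. I §5 no. 5 (transport of structure for homogeneous spaces); Kottwitz1986 §3 (fixed points of `γ` on `G ⧸ K` in orbital integrals)]

## References
* [BourbakiAlgebraI1989] N. Bourbaki, *Algebra I, Chapters 1–3* (1989), Ch. I §5 no. 5–7.
* [Kottwitz1986] R. E. Kottwitz, *Base change for unit elements of Hecke algebras*, Compositio Math. 60 (1986), §3.
-/

namespace Literature.GroupTheory

open MulAction

variable {G G' : Type*} [Group G] [Group G'] (K : Subgroup G) (K' : Subgroup G') (e : G ≃* G')

/-- **`G ⧸ K ≃ G′ ⧸ K′` along `e`, equivariantly** (`gK ↦ e(g)K′`). [cite: BourbakiAlgebraI1989, Ch. I §5 no. 5] [cite: Kottwitz1986, §3] -/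
theorem exists_equiv_quotient_congr (hK : ∀ g : G, g ∈ K ↔ e g ∈ K') :
    ∃ Ψ : G ⧸ K ≃ G' ⧸ K', (∀ g : G, Ψ (QuotientGroup.mk g) = QuotientGroup.mk (e g)) ∧
      ∀ (γ : G) (q : G ⧸ K), Ψ (γ • q) = e γ • Ψ q := by
  let Ψ : G ⧸ K ≃ G' ⧸ K' :=
    Quotient.congr (e : G ≃ G') fun a b => by
      rw [QuotientGroup.leftRel_apply, QuotientGroup.leftRel_apply, hK, map_mul, map_inv]
      rfl
  have hΨ : ∀ g : G, Ψ (g : G ⧸ K) = (e g : G' ⧸ K') := fun g => Quotient.congr_mk _ _ g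
  refine ⟨Ψ, hΨ, fun γ q => ?_⟩
  induction q using QuotientGroup.induction_on with
  | H g => rw [MulAction.Quotient.smul_mk, hΨ, hΨ, MulAction.Quotient.smul_mk, smul_eq_mul, smul_eq_mul, map_mul]

/-- Fixed points correspond under the equivariant bijection. [cite: Kottwitz1986, §3] -/
theorem mem_fixedBy_quotient_congr_iff (Ψ : G ⧸ K ≃ G' ⧸ K') (hΨ : ∀ (γ : G) (q : G ⧸ K), Ψ (γ • q) = e γ • Ψ q)
    (γ : G) (q : G ⧸ K) : q ∈ fixedBy (G ⧸ K) γ ↔ Ψ q ∈ fixedBy (G' ⧸ K') (e γ) := by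
  rw [mem_fixedBy, mem_fixedBy, ← hΨ, Ψ.apply_eq_iff_eq]

/-- `Ψ '' Fix_γ = Fix_{e γ}`. [cite: Kottwitz1986, §3] -/
theorem image_fixedBy_quotient_congr_eq (Ψ : G ⧸ K ≃ G' ⧸ K') (hΨ : ∀ (γ : G) (q : G ⧸ K), Ψ (γ • q) = e γ • Ψ q) (γ : G) :
    Ψ '' fixedBy (G ⧸ K) γ = fixedBy (G' ⧸ K') (e γ) := by
  ext p
  constructor
  · rintro ⟨q, hq, rfl⟩; exact (mem_fixedBy_quotient_congr_iff K K' e Ψ hΨ γ q).1 hq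
  · intro hp
    exact ⟨Ψ.symm p, (mem_fixedBy_quotient_congr_iff K K' e Ψ hΨ γ _).2 (by simpa using hp), Ψ.apply_symm_apply p⟩

/-- **Stratified fixed-point counts agree**: `#{q ∈ Fix_γ | pr (Ψ q)} = #{p ∈ Fix_{eγ} | pr p}`. [cite: Kottwitz1986, §3] -/
theorem ncard_sep_fixedBy_quotient_congr_eq (Ψ : G ⧸ K ≃ G' ⧸ K') (hΨ : ∀ (γ : G) (q : G ⧸ K), Ψ (γ • q) = e γ • Ψ q) (γ : G)
    (pr : G' ⧸ K' → Prop) :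
    {q ∈ fixedBy (G ⧸ K) γ | pr (Ψ q)}.ncard = {p ∈ fixedBy (G' ⧸ K') (e γ) | pr p}.ncard := by
  have himg : Ψ '' {q ∈ fixedBy (G ⧸ K) γ | pr (Ψ q)} = {p ∈ fixedBy (G' ⧸ K') (e γ) | pr p} := by
    ext p
    constructor
    · rintro ⟨q, ⟨hq, hpq⟩, rfl⟩; exact ⟨(mem_fixedBy_quotient_congr_iff K K' e Ψ hΨ γ q).1 hq, hpq⟩
    · rintro ⟨hp, hpp⟩
      exact ⟨Ψ.symm p, ⟨(mem_fixedBy_quotient_congr_iff K K' e Ψ hΨ γ _).2 (by simpa using hp), by simpa using hpp⟩, Ψ.apply_symm_apply p⟩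
  rw [← himg, Set.ncard_image_of_injective _ Ψ.injective]

/-- **Values at representatives agree** for `f′ : G′ → E` invariant under `K′`-conjugation: `f′ (e (q.out⁻¹ γ q.out)) = f′ ((Ψ q).out⁻¹ (e γ) (Ψ q).out)`.
[cite: Kottwitz1986, §3] -/
theorem apply_out_conj_congr_eq_of_conj_invariant {E : Type*} (Ψ : G ⧸ K ≃ G' ⧸ K')
    (hΨ1 : ∀ g : G, Ψ (QuotientGroup.mk g) = QuotientGroup.mk (e g)) (f' : G' → E) (hf' : ∀ k ∈ K', ∀ x, f' (k * x * k⁻¹) = f' x)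
    (γ : G) (q : G ⧸ K) :
    f' (e (q.out⁻¹ * γ * q.out)) = f' ((Ψ q).out⁻¹ * e γ * (Ψ q).out) := by
  -- `(Ψ q).out = e (q.out) * k′` with `k′ ∈ K′`
  have hq : Ψ q = QuotientGroup.mk (e q.out) := by
    conv_lhs => rw [← QuotientGroup.out_eq' q]
    exact hΨ1 q.out
  have hk : (e q.out)⁻¹ * (Ψ q).out ∈ K' := by
    rw [← QuotientGroup.eq, ← hq, QuotientGroup.out_eq']
  have hconj : (Ψ q).out⁻¹ * e γ * (Ψ q).out =
      ((e q.out)⁻¹ * (Ψ q).out)⁻¹ * e (q.out⁻¹ * γ * q.out) * ((e q.out)⁻¹ * (Ψ q).out)⁻¹⁻¹ := by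
    rw [map_mul, map_mul, map_inv, inv_inv]; group
  rw [hconj, hf' _ (K'.inv_mem hk)]

/-- **Fixed-point sums agree along a group isomorphism**: `Σᶠ_{q ∈ Fix_γ(G⧸K)} f′ (e (q.out⁻¹ γ q.out)) = Σᶠ_{p ∈ Fix_{eγ}(G′⧸K′)} f′ (p.out⁻¹ (e γ) p.out)` for
`f′` invariant under `K′`-conjugation. [cite: Kottwitz1986, §3] [cite: BourbakiAlgebraI1989, Ch. I §5 no. 5] -/
theorem finsum_mem_fixedBy_quotient_congr_eq {E : Type*} [AddCommMonoid E] (hK : ∀ g : G, g ∈ K ↔ e g ∈ K') (f' : G' → E)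
    (hf' : ∀ k ∈ K', ∀ x, f' (k * x * k⁻¹) = f' x) (γ : G) :
    ∑ᶠ q ∈ fixedBy (G ⧸ K) γ, f' (e (q.out⁻¹ * γ * q.out)) = ∑ᶠ p ∈ fixedBy (G' ⧸ K') (e γ), f' (p.out⁻¹ * e γ * p.out) := by
  obtain ⟨Ψ, hΨ1, hΨ⟩ := exists_equiv_quotient_congr K K' e hK
  calc ∑ᶠ q ∈ fixedBy (G ⧸ K) γ, f' (e (q.out⁻¹ * γ * q.out))
      = ∑ᶠ q ∈ fixedBy (G ⧸ K) γ, f' ((Ψ q).out⁻¹ * e γ * (Ψ q).out) :=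
        finsum_mem_congr rfl fun q _ => apply_out_conj_congr_eq_of_conj_invariant K K' e Ψ hΨ1 f' hf' γ q
    _ = ∑ᶠ p ∈ Ψ '' fixedBy (G ⧸ K) γ, f' (p.out⁻¹ * e γ * p.out) :=
        (finsum_mem_image (f := fun p : G' ⧸ K' => f' (p.out⁻¹ * e γ * p.out)) Ψ.injective.injOn).symm
    _ = ∑ᶠ p ∈ fixedBy (G' ⧸ K') (e γ), f' (p.out⁻¹ * e γ * p.out) := by rw [image_fixedBy_quotient_congr_eq K K' e Ψ hΨ γ]

end Literature.GroupTheory
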